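import Mathlib
import HarnessLib
import Summits.Langlands.Langlands.Theses.SkinnerWilesDefectOne
import Literature.NumberTheory.GaloisRepresentations.NearlyOrdinaryDeformationRing
import Literature.NumberTheory.Automorphic.POrdinaryHeckeAlgebraGL2
import Summits.Langlands.Langlands.Theorems.SkinnerWilesDefectOneReducibleOrdinaryProModularGenericEisensteinDefs

/-!
# The reducibility ideal of a two-dimensional determinant in a diagonal basis (Bellaïche–Chenevier):
# helper for stub `stub_eisensteinDivisor` of line generic-eisenstein-rigidity (crux ReducibleOrdinaryProModular, stmt-Langlands-12919)

Route `SkinnerWilesDefectOne`, line lead's helper file (wave 1, stub-worker output integrated by the lead).  Pure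
two-by-two algebra over a commutative ring `A` for the vocabulary `redIdeal` of the line's Defs file
(`…GenericEisensteinDefs`): `PseudoRep2.ofRep_map`, `ofRep_conj`, `ofRep_eq_ofCharacters` (upper triangular ⇒
sum of the diagonal characters), `exists_ofRep_eq_ofCharacters`; monotonicity `exists_ofCharacters_mono`,
`redIdeal_le_of_isReducible`, `exists_ofCharacters_top` (the defining set of `redIdeal` is non-empty); and the
Bellaïche–Chenevier computation **`redIdeal (ofRep ρ) = (b_γ c_γ' : γ, γ')`** when some `ρ(g₀)` is diagonal with
unit difference of eigenvalues (`redIdeal_ofRep_eq_span`, framed form `redIdeal_ofRep_eq_span_frame`) — the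
input of `Spec R_𝒟^red = V(I)` in the companion file `…GenericEisensteinReducibleLocusAux`.

The last theorem `stub_eisensteinDivisor_auxRedIdealSpan` is the registered one-line wrapper (sub-goal of
stmt-Langlands-12919) through which this helper file lands.

References: J. Bellaïche, G. Chenevier, *Families of Galois representations and Selmer groups*, Astérisque 324
(2009), §1.5, Prop. 1.5.1; C. M. Skinner, A. J. Wiles, Publ. Math. IHÉS 89 (1999), §2.2.
-/

set_option linter.dupNamespace false

namespace Summit.Langlands.Langlands.Cruxes.ReducibleOrdinaryProModular.GenericEisensteinRigidity

open Summit.Langlands.Langlands.Theses.SkinnerWilesDefectOne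
open Literature.NumberTheory.Automorphic Literature.NumberTheory.Automorphic.BigHeckeGLn
open Literature.NumberTheory.GaloisRepresentations
open NumberField IsDedekindDomain IsLocalRing Filter Field
open scoped MatrixGroups Matrix NumberField NNReal

noncomputable section

/-! ## §1 Two-by-two determinant algebra -/

section Algebra

variable {Γ : Type*} [Group Γ] {A B : Type*} [CommRing A] [CommRing B]

/-- `ofRep` commutes with extension of scalars. [folklore] -/
theorem PseudoRep2.ofRep_map (ρ : Γ →* GL (Fin 2) A) (f : A →+* B) :
    (PseudoRep2.ofRep ρ).map f = PseudoRep2.ofRep ((Matrix.GeneralLinearGroup.map f).comp ρ) := by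
  refine PseudoRep2.ext (funext fun γ => ?_) (MonoidHom.ext fun γ => Units.ext ?_)
  · simp only [PseudoRep2.map_trace, PseudoRep2.ofRep_trace, MonoidHom.comp_apply,
      Matrix.trace_fin_two, map_add]
    rfl
  · simp only [PseudoRep2.map_det, PseudoRep2.ofRep_det, MonoidHom.comp_apply,
      Matrix.det_fin_two, map_sub, map_mul]
    rfl

/-- `ofRep` is invariant under conjugation of the representation. [folklore] -/
theorem PseudoRep2.ofRep_conj (ρ : Γ →* GL (Fin 2) A) (P : GL (Fin 2) A) :
    PseudoRep2.ofRep ((MulAut.conj P).toMonoidHom.comp ρ) = PseudoRep2.ofRep ρ := by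
  refine PseudoRep2.ext (funext fun γ => ?_) (MonoidHom.ext fun γ => Units.ext ?_)
  · simp only [PseudoRep2.ofRep_trace, MonoidHom.comp_apply, MulEquiv.coe_toMonoidHom,
      MulAut.conj_apply, Units.val_mul, Matrix.coe_units_inv]
    rw [← Matrix.coe_units_inv]
    exact Matrix.trace_units_conj P _
  · simp only [PseudoRep2.ofRep_det, MonoidHom.comp_apply, MulEquiv.coe_toMonoidHom,
      MulAut.conj_apply, Units.val_mul]
    exact Matrix.det_units_conj P _

/-- Entries of a product of two `GL₂` elements. [folklore] -/
theorem GL2_mul_apply (M N : GL (Fin 2) A) (i j : Fin 2) :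
    (M * N).val i j = M.val i 0 * N.val 0 j + M.val i 1 * N.val 1 j := by
  rw [Units.val_mul, Matrix.mul_apply, Fin.sum_univ_two]

/-- The determinant of an UPPER-TRIANGULAR representation is the sum of its two diagonal characters.
[folklore] -/
theorem PseudoRep2.ofRep_eq_ofCharacters (ρ : Γ →* GL (Fin 2) A) (h : ∀ γ, (ρ γ).val 1 0 = 0) :
    PseudoRep2.ofRep ρ =
      PseudoRep2.ofCharacters (Deformation.diagChar ρ h 0) (Deformation.diagChar ρ h 1) := by
  refine PseudoRep2.ext (funext fun γ => ?_) (MonoidHom.ext fun γ => Units.ext ?_)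
  · simp [Matrix.trace_fin_two]
  · simp [Matrix.det_fin_two, h γ]

/-- A representation conjugate to an upper-triangular one has determinant a sum of two characters.
[folklore] -/
theorem PseudoRep2.exists_ofRep_eq_ofCharacters (ρ : Γ →* GL (Fin 2) A)
    (h : Deformation.IsReducible ρ) :
    ∃ χ₁ χ₂ : Γ →* Aˣ, PseudoRep2.ofRep ρ = PseudoRep2.ofCharacters χ₁ χ₂ := by
  obtain ⟨P, hP⟩ := h
  have hP' : ∀ γ, (((MulAut.conj P⁻¹).toMonoidHom.comp ρ) γ).val 1 0 = 0 := fun γ => by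
    simpa [MulAut.conj_apply] using hP γ
  refine ⟨Deformation.diagChar _ hP' 0, Deformation.diagChar _ hP' 1, ?_⟩
  rw [← PseudoRep2.ofRep_conj ρ P⁻¹]
  exact PseudoRep2.ofRep_eq_ofCharacters _ hP'

end Algebra

/-! ## §2 The reducibility ideal -/

section RedIdeal

variable {Γ : Type*} [Group Γ] {A : Type*} [CommRing A]

/-- "`D mod J` is a sum of two characters" is MONOTONE in `J`. [folklore] -/
theorem exists_ofCharacters_mono (D : PseudoRep2 Γ A) {J J' : Ideal A} (hle : J ≤ J')
    (h : ∃ χ₁ χ₂ : Γ →* (A ⧸ J)ˣ, D.map (Ideal.Quotient.mk J) = PseudoRep2.ofCharacters χ₁ χ₂) :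
    ∃ χ₁ χ₂ : Γ →* (A ⧸ J')ˣ, D.map (Ideal.Quotient.mk J') = PseudoRep2.ofCharacters χ₁ χ₂ := by
  obtain ⟨χ₁, χ₂, hJ⟩ := h
  refine ⟨(Units.map (Ideal.Quotient.factor hle : A ⧸ J →* A ⧸ J')).comp χ₁,
    (Units.map (Ideal.Quotient.factor hle : A ⧸ J →* A ⧸ J')).comp χ₂, ?_⟩
  rw [← Ideal.Quotient.factor_comp_mk hle, ← PseudoRep2.map_map, hJ, PseudoRep2.ofCharacters_map]

/-- If `ρ mod J` is reducible (conjugate over `A/J` to an upper-triangular representation) then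
`redIdeal (ofRep ρ) ≤ J`. [folklore] -/
theorem redIdeal_le_of_isReducible (ρ : Γ →* GL (Fin 2) A) (J : Ideal A)
    (h : Deformation.IsReducible ((Matrix.GeneralLinearGroup.map (Ideal.Quotient.mk J)).comp ρ)) :
    redIdeal (PseudoRep2.ofRep ρ) ≤ J := by
  apply redIdeal_le
  obtain ⟨χ₁, χ₂, hχ⟩ := PseudoRep2.exists_ofRep_eq_ofCharacters _ h
  exact ⟨χ₁, χ₂, by rw [PseudoRep2.ofRep_map, hχ]⟩

/-- `⊤` is always admissible (over the zero ring every determinant is `1 ⊕ 1`), so the defining set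
of `redIdeal` is non-empty. [folklore] -/
theorem exists_ofCharacters_top (D : PseudoRep2 Γ A) :
    ∃ χ₁ χ₂ : Γ →* (A ⧸ (⊤ : Ideal A))ˣ,
      D.map (Ideal.Quotient.mk ⊤) = PseudoRep2.ofCharacters χ₁ χ₂ := by
  haveI : Subsingleton (A ⧸ (⊤ : Ideal A)) := Ideal.Quotient.subsingleton_iff.mpr rfl
  refine ⟨1, 1, PseudoRep2.ext (funext fun γ => Subsingleton.elim _ _)
    (MonoidHom.ext fun γ => Units.ext (Subsingleton.elim _ _))⟩

/-- **The reducibility ideal in a diagonal basis (Bellaïche–Chenevier).**  If `ρ(g₀) = diag(α, δ)`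
with `α − δ ∈ Aˣ` and `ρ(γ) = (a_γ b_γ; c_γ d_γ)`, then `redIdeal (ofRep ρ)` is the ideal generated by
the products `b_γ c_γ'`: modulo `J`, `tr ρ = χ₁ + χ₂` with `det ρ = χ₁χ₂` forces
`(α − δ)·a_γ ≡ E χ₁(γ) + F χ₂(γ)` with `E F = 0`, `E + F = α − δ`, hence `a` multiplicative mod `J`,
i.e. `b_γ c_γ' = a_{γγ'} − a_γ a_γ' ∈ J`; conversely modulo `(b_γ c_γ')` the diagonal entries ARE
characters with `tr = a + d`, `det ≡ a d`. [cite: BellaicheChenevier2009, §1.5 Prop. 1.5.1] -/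
theorem redIdeal_ofRep_eq_span (ρ : Γ →* GL (Fin 2) A) (g₀ : Γ)
    (h01 : (ρ g₀).val 0 1 = 0) (h10 : (ρ g₀).val 1 0 = 0)
    (hunit : IsUnit ((ρ g₀).val 0 0 - (ρ g₀).val 1 1)) :
    redIdeal (PseudoRep2.ofRep ρ) =
      Ideal.span (Set.range fun γ : Γ × Γ => (ρ γ.1).val 0 1 * (ρ γ.2).val 1 0) := by
  set J₀ : Ideal A := Ideal.span (Set.range fun γ : Γ × Γ => (ρ γ.1).val 0 1 * (ρ γ.2).val 1 0)
    with hJ₀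
  have hbc : ∀ γ γ', (ρ γ).val 0 1 * (ρ γ').val 1 0 ∈ J₀ := fun γ γ' =>
    Ideal.subset_span ⟨(γ, γ'), rfl⟩
  apply le_antisymm
  · -- `J₀` is admissible: modulo `J₀` the diagonal entries are characters
    apply redIdeal_le
    set f : A →+* A ⧸ J₀ := Ideal.Quotient.mk J₀ with hf
    have hf0 : ∀ γ γ', f ((ρ γ).val 0 1 * (ρ γ').val 1 0) = 0 := fun γ γ' =>
      (Ideal.Quotient.eq_zero_iff_mem).mpr (hbc γ γ')
    let φ₁ : Γ →* A ⧸ J₀ :=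
      { toFun := fun γ => f ((ρ γ).val 0 0)
        map_one' := by simp
        map_mul' := fun γ γ' => by
          show f ((ρ (γ * γ')).val 0 0) = f ((ρ γ).val 0 0) * f ((ρ γ').val 0 0)
          rw [map_mul ρ, GL2_mul_apply, map_add, map_mul, hf0, add_zero] }
    let φ₂ : Γ →* A ⧸ J₀ :=
      { toFun := fun γ => f ((ρ γ).val 1 1)
        map_one' := by simp
        map_mul' := fun γ γ' => by
          show f ((ρ (γ * γ')).val 1 1) = f ((ρ γ).val 1 1) * f ((ρ γ').val 1 1)
          rw [map_mul ρ, GL2_mul_apply, map_add, map_mul, map_mul, mul_comm (f ((ρ γ).val 1 0)),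
            ← map_mul f ((ρ γ').val 0 1), hf0, zero_add] }
    refine ⟨φ₁.toHomUnits, φ₂.toHomUnits, PseudoRep2.ext (funext fun γ => ?_)
      (MonoidHom.ext fun γ => Units.ext ?_)⟩
    · simp only [PseudoRep2.map_trace, PseudoRep2.ofRep_trace, Matrix.trace_fin_two, map_add,
        PseudoRep2.ofCharacters_trace, MonoidHom.coe_toHomUnits]
      rfl
    · simp only [PseudoRep2.map_det, PseudoRep2.ofRep_det, Matrix.det_fin_two, map_sub, map_mul,
        PseudoRep2.ofCharacters_det, Units.val_mul, MonoidHom.coe_toHomUnits]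
      rw [← map_mul f ((ρ γ).val 0 1), hf0, sub_zero]
      rfl
  · -- every admissible `J` contains the products `b_γ c_γ'`
    apply le_sInf
    rintro J ⟨χ₁, χ₂, hJ⟩
    rw [Ideal.span_le]
    rintro _ ⟨⟨γ, γ'⟩, rfl⟩
    set f : A →+* A ⧸ J := Ideal.Quotient.mk J with hf
    rw [SetLike.mem_coe, ← Ideal.Quotient.eq_zero_iff_mem]
    change f ((ρ γ).val 0 1 * (ρ γ').val 1 0) = 0
    -- trace and determinant identities modulo `J`
    have htr : ∀ g, f ((ρ g).val 0 0) + f ((ρ g).val 1 1) = χ₁ g + χ₂ g := fun g => by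
      have := congrArg (fun D : PseudoRep2 Γ (A ⧸ J) => D.trace g) hJ
      simpa [Matrix.trace_fin_two] using this
    have hdet : ∀ g, f ((ρ g).val 0 0) * f ((ρ g).val 1 1) - f ((ρ g).val 0 1) * f ((ρ g).val 1 0) =
        χ₁ g * χ₂ g := fun g => by
      have := congrArg (fun D : PseudoRep2 Γ (A ⧸ J) => (D.det g : A ⧸ J)) hJ
      simpa [Matrix.det_fin_two] using this
    -- notation
    set al := f ((ρ g₀).val 0 0) with hal
    set de := f ((ρ g₀).val 1 1) with hde
    set u : A ⧸ J := ((χ₁ g₀ : (A ⧸ J)ˣ) : A ⧸ J) with hu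
    set v : A ⧸ J := ((χ₂ g₀ : (A ⧸ J)ˣ) : A ⧸ J) with hv
    have e1 : al + de = u + v := htr g₀
    have e2 : al * de = u * v := by
      have h := hdet g₀
      rw [h01, map_zero, zero_mul, sub_zero] at h
      exact h
    -- `tr ρ(g₀ g) = α a_g + δ d_g`
    have e4 : ∀ g, al * f ((ρ g).val 0 0) + de * f ((ρ g).val 1 1) = u * χ₁ g + v * χ₂ g := by
      intro g
      have h := htr (g₀ * g)
      rw [map_mul ρ, GL2_mul_apply, GL2_mul_apply, h01, h10, map_mul χ₁, map_mul χ₂] at h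
      simpa [Units.val_mul] using h
    have e5 : f ((ρ (γ * γ')).val 0 0) =
        f ((ρ γ).val 0 0) * f ((ρ γ').val 0 0) + f ((ρ γ).val 0 1 * (ρ γ').val 1 0) := by
      rw [map_mul ρ, GL2_mul_apply, map_add, map_mul]
    set s := al - de with hs
    set E := u - de with hE
    set F := v - de with hF
    have hsEF : s = E + F := by linear_combination e1
    have hEF : E * F = 0 := by linear_combination -e2 + de * e1
    have hA : ∀ g, s * f ((ρ g).val 0 0) = E * χ₁ g + F * χ₂ g := fun g => by
      linear_combination e4 g - de * htr g
    have key : s ^ 2 * f ((ρ γ).val 0 1 * (ρ γ').val 1 0) = 0 := by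
      have h1 : s ^ 2 * f ((ρ γ).val 0 1 * (ρ γ').val 1 0) =
          s * (s * f ((ρ (γ * γ')).val 0 0)) -
            (s * f ((ρ γ).val 0 0)) * (s * f ((ρ γ').val 0 0)) := by
        linear_combination (-(s ^ 2)) * e5
      rw [hA, hA, hA, map_mul χ₁, map_mul χ₂] at h1
      simp only [Units.val_mul] at h1
      linear_combination h1 +
        (E * ((χ₁ γ : A ⧸ J) * χ₁ γ') + F * ((χ₂ γ : A ⧸ J) * χ₂ γ')) * hsEF +
        (((χ₁ γ : A ⧸ J) - χ₂ γ) * ((χ₁ γ' : A ⧸ J) - χ₂ γ')) * hEF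
    have hsu : IsUnit s := by
      rw [hs, hal, hde, ← map_sub]
      exact hunit.map f
    exact ((hsu.pow 2).mul_right_eq_zero).mp key

/-- The same in a diagonal FRAME `D`: if `D⁻¹ ρ(g₀) D = diag(α, δ)` with `α − δ` a unit then
`redIdeal (ofRep ρ)` is generated by the products `b_γ c_γ'` of the off-diagonal entries of
`D⁻¹ ρ D`. [cite: BellaicheChenevier2009, §1.5 Prop. 1.5.1] -/
theorem redIdeal_ofRep_eq_span_frame (ρ : Γ →* GL (Fin 2) A) (D : GL (Fin 2) A) (g₀ : Γ)
    (h01 : (D⁻¹ * ρ g₀ * D).val 0 1 = 0) (h10 : (D⁻¹ * ρ g₀ * D).val 1 0 = 0)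
    (hunit : IsUnit ((D⁻¹ * ρ g₀ * D).val 0 0 - (D⁻¹ * ρ g₀ * D).val 1 1)) :
    redIdeal (PseudoRep2.ofRep ρ) =
      Ideal.span (Set.range fun γ : Γ × Γ =>
        (D⁻¹ * ρ γ.1 * D).val 0 1 * (D⁻¹ * ρ γ.2 * D).val 1 0) := by
  have hc : ∀ γ, ((MulAut.conj D⁻¹).toMonoidHom.comp ρ) γ = D⁻¹ * ρ γ * D := fun γ => by
    simp
  rw [← PseudoRep2.ofRep_conj ρ D⁻¹, redIdeal_ofRep_eq_span _ g₀ (by rw [hc]; exact h01)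
    (by rw [hc]; exact h10) (by rw [hc]; exact hunit)]
  simp_rw [hc]

end RedIdeal

/-! ## §3 The swap frame -/

section Swap

variable {A : Type*} [CommRing A]

/-- **The swap frame** `w = (0 1; 1 0)`: conjugation by `w` exchanges `00 ↔ 11` and `01 ↔ 10`.
[folklore] -/
theorem exists_swap_conj :
    ∃ w : GL (Fin 2) A, ∀ X : GL (Fin 2) A,
      (w⁻¹ * X * w).val 0 0 = X.val 1 1 ∧ (w⁻¹ * X * w).val 0 1 = X.val 1 0 ∧
      (w⁻¹ * X * w).val 1 0 = X.val 0 1 ∧ (w⁻¹ * X * w).val 1 1 = X.val 0 0 := by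
  let w : GL (Fin 2) A :=
    ⟨!![0, 1; 1, 0], !![0, 1; 1, 0],
      by ext i j; fin_cases i <;> fin_cases j <;> simp [Matrix.mul_apply, Fin.sum_univ_two],
      by ext i j; fin_cases i <;> fin_cases j <;> simp [Matrix.mul_apply, Fin.sum_univ_two]⟩
  have h1 : (w⁻¹).val = !![0, 1; 1, 0] := rfl
  have h2 : w.val = !![0, 1; 1, 0] := rfl
  refine ⟨w, fun X => ?_⟩
  rw [Units.val_mul, Units.val_mul]
  simp only [Matrix.mul_apply, Fin.sum_univ_two]
  rw [h1, h2]
  simp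

end Swap


/-! ## §4 Registered wrapper -/

/-- **Registered wrapper** (sub-goal `stub_eisensteinDivisor_auxRedIdealSpan` of stmt-Langlands-12919): the
Bellaïche–Chenevier description of the reducibility ideal in a diagonal basis.
[cite: BellaicheChenevier2009, §1.5 Prop. 1.5.1] -/
theorem stub_eisensteinDivisor_auxRedIdealSpan :
    ∀ (Γ : Type) [Group Γ] (A : Type) [CommRing A] (ρ : Γ →* GL (Fin 2) A) (g₀ : Γ),
      (ρ g₀).val 0 1 = 0 → (ρ g₀).val 1 0 = 0 → IsUnit ((ρ g₀).val 0 0 - (ρ g₀).val 1 1) →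
      redIdeal (PseudoRep2.ofRep ρ) =
        Ideal.span (Set.range fun γ : Γ × Γ => (ρ γ.1).val 0 1 * (ρ γ.2).val 1 0) :=
  fun _ _ _ _ ρ g₀ h01 h10 hunit => redIdeal_ofRep_eq_span ρ g₀ h01 h10 hunit

end

end Summit.Langlands.Langlands.Cruxes.ReducibleOrdinaryProModular.GenericEisensteinRigidity
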